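import Mathlib
import Summits.QuantumFields.YangMills.Theses.GuardedThresholdRemoval
import Summits.QuantumFields.YangMills.Theses.SpecificationCompactness
import Summits.QuantumFields.YangMills.Theorems.GuardedThresholdRemovalGuardCollarHaarSmall

/-!
# Route `GuardedThresholdRemoval`: the crux `GuardSphereThin` (stmt-QuantumFields-28025) ⇐ the uniform-integrability crux
# `SpecificationCompactness.UnitDensityUI` (stmt-QuantumFields-28251) — a DOOR from a WEAKER, SHARED residual

WHAT IS PROVED.  `GuardSphereThin` — K-uniform thinness of the guard collars `{u : ∃ c i, |dist₁(W_{c,i}(u)) − δ| < η}` under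
Bałaban's unit laws `unitLaw_K` of the printed run (`ℰp = expMeanLogSU`, guard radius `δ`) — follows from
(1) `SpecificationCompactness.UnitDensityUI`: the normalised renormalised unit densities `d_K = ρ̂_K/∫ρ̂_K dπ₀` are uniformly
integrable w.r.t. product Haar `π₀` on `T₁`, K-uniformly (`∀ ε ∃ M K₀ ∀ K ≥ K₀, ∫ (d_K − M)₊ dπ₀ ≤ ε`), and
(2) `GuardCollarHaarSmall` (stmt-QuantumFields-28046, PROVED in tree: `guardedThresholdRemoval_guardCollarHaarSmall_proof`).
The second theorem discharges (2), so `GuardSphereThin ⇐ UnitDensityUI` outright.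

THE PROOF (elementary measure theory over tree lemmas; no renormalisation-group content).  `unitLaw_K = π₀.withDensity(Z_K⁻¹ρ̂_K)`
(`T3UnitLawDensityEML.unitLaw_eq_withDensity_emlDensity`) and `∫ρ̂_K dπ₀ = Z_K` (total mass one; re-proved inline, cf. the parallel
`SpecificationCompactnessKernel.integral_unitDensity`),
so the UI clause is about `d_K = Z_K⁻¹ρ̂_K`; the collar `S_η` is measurable (`GuardCollarHaarSmall.measurableSet_collar`); and with
`M' = max(M,1)`: `unitLaw_K(S_η) = ∫_{S_η} d_K dπ₀ ≤ M'·π₀(S_η) + ∫ (d_K − M)₊ dπ₀ ≤ M'·ε/(2M') + ε/2 = ε` for `K ≥ K₀`, choosing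
`(M, K₀)` from UI at `ε/2` and `η` from Haar-smallness at `ε/(2M')`.

WHY IT MATTERS FOR THE ROUTE (planner of record, ym-idea-1 g13).  The route's split of `GuardSphereThin` hangs it on the K-uniform
`L^∞` collar domination `UnitLawCollarDominated` (stmt-QuantumFields-28045).  Uniform integrability is STRICTLY WEAKER (`L^∞`-domination
⇒ UI), is robust to the refuter's fixed-`K` concern on 28045 (a fold of the block-loop map could make `d unitLaw_K/dπ₀` unbounded at
critical values, which kills an `L^∞` form but not UI), and is ALREADY a tribunal-passed crux of route `SpecificationCompactness`
BY NAME, with its own landed door from the height-0 clause of `T3HeightwiseDensityBounds.HeightwiseUpperBound`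
(`SpecificationCompactnessKernel.unitDensityUI_of_heightwiseUpperBound`).  So the two routes now share ONE residual, staffed once.

HONEST FRAMING.  A door between two OPEN items; `UnitDensityUI` (one-sided ultraviolet stability of the renormalised unit law in
`L¹`-tail form) is NOT proved here; rung R3 is a RECORD rung; nothing about `ContinuumYM3Torus`, `YM3TorusSU2` or the Yang–Mills
mass gap is proved.
-/

noncomputable section

open MeasureTheory Filter Topology
open scoped ENNReal

namespace Summit.QuantumFields.YangMills.Theorems.GuardedThresholdRemovalGuardSphereThinOfUI

open Summit.QuantumFields.YangMills.Theses.GuardedThresholdRemoval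
open Literature.MathematicalPhysics.QuantumFieldTheory.Balaban1983to89
open Literature.MathematicalPhysics.QuantumFieldTheory.Balaban1983to89.T3ContinuumYM3Torus
open Literature.MathematicalPhysics.QuantumFieldTheory.Balaban1983to89.T3LevelShift
open Literature.MathematicalPhysics.QuantumFieldTheory.Balaban1983to89.Missing
open Literature.MathematicalPhysics.QuantumFieldTheory.Balaban1983to89.T4Continuum
open Literature.MathematicalPhysics.QuantumFieldTheory.Balaban1983to89.T3ThresholdRemoval
open Literature.MathematicalPhysics.QuantumFieldTheory.Balaban1983to89.T3UnitLawDensityEML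

/-- **GUARD-SPHERE THINNESS ⇐ UNIFORM INTEGRABILITY OF THE NORMALISED UNIT DENSITIES ∧ HAAR-SMALL COLLARS**: if the normalised
renormalised unit densities `ρ̂_K/∫ρ̂_K dπ₀` are uniformly integrable w.r.t. product Haar, K-uniformly for `0 < γ ≤ γ₁`
(`SpecificationCompactness.UnitDensityUI`), and the guard collars are Haar-small (`GuardCollarHaarSmall`), then the unit laws give the
`η`-collars mass `≤ ε` for all `K ≥ K₀`, with `η, K₀` uniform in `K` (`GuardSphereThin`, `γ₂ := γ₁`). [cite: Balaban1985UV3, (2) p.256 + (6) p.257] -/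
theorem guardSphereThin_of_unitDensityUI_of_collar
    (hUI : Summit.QuantumFields.YangMills.Theses.SpecificationCompactness.UnitDensityUI)
    (hH : GuardCollarHaarSmall) : GuardSphereThin := by
  obtain ⟨γ₁, hγ₁, hU⟩ := hUI
  refine ⟨γ₁, hγ₁, fun F γ hγ hγle ε hε => ?_⟩
  obtain ⟨M, K₀, hM⟩ := hU F γ hγ hγle (ε / 2) (by positivity)
  set M' : ℝ := max M 1 with hM'
  have hM'pos : 0 < M' := lt_max_of_lt_right one_pos
  have hMM' : M ≤ M' := le_max_left _ _
  obtain ⟨η, hη, hsmall⟩ := hH F (ε / (2 * M')) (by positivity)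
  refine ⟨η, hη, K₀, fun K hK => ?_⟩
  set π₀ := fieldMeasure (F.P 0) 0 (Matrix.specialUnitaryGroup (Fin 2) ℂ) with hπ₀
  set S : Set (GaugeField (F.P 0) 0 (Matrix.specialUnitaryGroup (Fin 2) ℂ)) :=
    {u | ∃ (c : PBond (F.P 0) 1) (i : BlockAveraging.Idx (F.P 0)),
      |dist1 (BlockAveraging.loopHol u c i) - (ℰp).δ| < η} with hS
  have hSm : MeasurableSet S :=
    Summit.QuantumFields.YangMills.Theorems.GuardCollarHaarSmall.measurableSet_collar (P := F.P 0) (j := 0) (ℰp).δ η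
  -- the normalised density d = Z⁻¹ ρ̂_K
  set Z := partitionFn (G := Matrix.specialUnitaryGroup (Fin 2) ℂ) (F.P K) ((F.scheme ℰp γ).β K) with hZ
  have hZpos : 0 < Z := partitionFn_pos' _ (F.scheme_β_nonneg ℰp hγ.le K)
  obtain ⟨hdm, hd0, hdi⟩ := unitDensity_props F K hγ.le
  set d : GaugeField (F.P 0) 0 (Matrix.specialUnitaryGroup (Fin 2) ℂ) → ℝ := fun u => Z⁻¹ * unitDensity F γ K u with hd
  have hdm' : Measurable d := hdm.const_mul _
  have hd0' : ∀ u, 0 ≤ d u := fun u => mul_nonneg (inv_nonneg.mpr hZpos.le) (hd0 u)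
  have hdi' : Integrable d π₀ := hdi.const_mul _
  -- UI hypothesis at K, with (∫ρ̂)⁻¹ = Z⁻¹
  have hInt : ∫ W, unitDensity F γ K W ∂π₀ = Z := by
    haveI : IsProbabilityMeasure (F.unitLaw ℰp measurableE_ℰp γ K) :=
      isProbabilityMeasure_unitLaw (F := F) (ℰ := ℰp) measurableE_ℰp hγ.le K
    have h1 : (F.unitLaw ℰp measurableE_ℰp γ K) Set.univ = 1 := measure_univ
    rw [unitLaw_eq_withDensity_emlDensity F K hγ.le, withDensity_apply _ MeasurableSet.univ,
      Measure.restrict_univ] at h1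
    have h2 : ∫ u, d u ∂π₀ = 1 := by
      rw [integral_eq_lintegral_of_nonneg_ae (Eventually.of_forall fun u => hd0' u) hdm'.aestronglyMeasurable]
      change (∫⁻ u, ENNReal.ofReal (Z⁻¹ * unitDensity F γ K u) ∂π₀).toReal = 1
      rw [h1]; simp
    have h3 : ∫ u, d u ∂π₀ = Z⁻¹ * ∫ W, unitDensity F γ K W ∂π₀ := integral_const_mul _ _
    have hZne : Z ≠ 0 := hZpos.ne'
    have h4 : Z⁻¹ * ∫ W, unitDensity F γ K W ∂π₀ = 1 := h3 ▸ h2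
    calc ∫ W, unitDensity F γ K W ∂π₀ = Z * (Z⁻¹ * ∫ W, unitDensity F γ K W ∂π₀) := by
          rw [← mul_assoc, mul_inv_cancel₀ hZne, one_mul]
      _ = Z := by rw [h4, mul_one]
  have hUI' : ∫ V, max (d V - M) 0 ∂π₀ ≤ ε / 2 := by
    have h := hM K hK
    rw [hInt] at h
    exact h
  -- the unit law of S as an integral of d over S
  have hlaw : (F.unitLaw ℰp measurableE_ℰp γ K).real S = ∫ u in S, d u ∂π₀ := by
    rw [unitLaw_eq_withDensity_emlDensity F K hγ.le, measureReal_def, withDensity_apply _ hSm,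
      integral_eq_lintegral_of_nonneg_ae (Eventually.of_forall fun u => hd0' u) hdm'.aestronglyMeasurable.restrict]
  -- pointwise: d ≤ M' + (d - M')₊ ≤ M' + (d - M)₊
  have hpt : ∀ u, d u ≤ M' + max (d u - M) 0 := by
    intro u
    have h1 : d u - M' ≤ max (d u - M) 0 := (sub_le_sub_left hMM' _).trans (le_max_left _ _)
    linarith
  have hposInt : Integrable (fun u => max (d u - M) 0) π₀ := (hdi'.sub (integrable_const M)).pos_part
  have hstep1 : ∫ u in S, d u ∂π₀ ≤ ∫ u in S, (M' + max (d u - M) 0) ∂π₀ :=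
    setIntegral_mono hdi'.integrableOn ((integrable_const M').add hposInt).integrableOn hpt
  have hstep2 : ∫ u in S, (M' + max (d u - M) 0) ∂π₀ = M' * π₀.real S + ∫ u in S, max (d u - M) 0 ∂π₀ := by
    rw [integral_add (integrable_const M').integrableOn hposInt.integrableOn, setIntegral_const, smul_eq_mul, mul_comm]
  have hstep3 : ∫ u in S, max (d u - M) 0 ∂π₀ ≤ ∫ u, max (d u - M) 0 ∂π₀ :=
    setIntegral_le_integral hposInt (Eventually.of_forall fun u => le_max_right _ _)
  have hHaar : π₀.real S ≤ ε / (2 * M') := hsmall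
  calc (F.unitLaw ℰp measurableE_ℰp γ K).real S = ∫ u in S, d u ∂π₀ := hlaw
    _ ≤ M' * π₀.real S + ∫ u, max (d u - M) 0 ∂π₀ := by linarith
    _ ≤ M' * (ε / (2 * M')) + ε / 2 := by gcongr
    _ = ε := by field_simp; ring

/-- **GUARD-SPHERE THINNESS ⇐ UNIFORM INTEGRABILITY OF THE NORMALISED UNIT DENSITIES** (the Haar-smallness of the collars is the
tree theorem `guardedThresholdRemoval_guardCollarHaarSmall_proof`, stmt-QuantumFields-28046): a door on the crux `GuardSphereThin`
(stmt-QuantumFields-28025) from the shared crux `SpecificationCompactness.UnitDensityUI` (stmt-QuantumFields-28251).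
[cite: Balaban1985UV3, (2) p.256 + (6) p.257] -/
theorem guardSphereThin_of_unitDensityUI
    (hUI : Summit.QuantumFields.YangMills.Theses.SpecificationCompactness.UnitDensityUI) : GuardSphereThin :=
  guardSphereThin_of_unitDensityUI_of_collar hUI
    Summit.QuantumFields.YangMills.Theorems.guardedThresholdRemoval_guardCollarHaarSmall_proof

end Summit.QuantumFields.YangMills.Theorems.GuardedThresholdRemovalGuardSphereThinOfUI
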